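import Summits.CriticalPhenomena.SAWScalingLimit.Theorems.SAWDevelopingMapObservableToSLETypeLadderCarvedReductionSqueezeOuterData
import Summits.CriticalPhenomena.SAWScalingLimit.Theorems.SAWDevelopingMapObservableToSLETypeLadderCarvedReductionSqueezeOmegaFacts
import Summits.CriticalPhenomena.SAWScalingLimit.Theorems.SAWDevelopingMapObservableToSLETypeLadderCarvedReductionSqueezeSides
import Summits.CriticalPhenomena.SAWScalingLimit.Theorems.SAWDevelopingMapObservableToSLETypeLadderCarvedReductionSqueezeGateCuts
import Summits.CriticalPhenomena.SAWScalingLimit.Theorems.SAWDevelopingMapObservableToSLETypeLadderCarvedReductionSqueezeBulkPathEv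
import HarnessLib

/-!
# The bulk of the bundled limit data (piece (T-A′₂F bulk of the data) of stub T-A′₂F
# `stub_carvedReduction_squeezeGeometry_domainsCoreF`)

Crux `SAWDevelopingMap.ObservableToSLE` (stmt-CriticalPhenomena-10472), line `six-class-type-ladder`,
stub T-A′₂F `stub_carvedReduction_squeezeGeometry_domainsCoreF`.  Landing target:
`Summits/CriticalPhenomena/SAWScalingLimit/Theorems/SAWDevelopingMapObservableToSLETypeLadderCarvedReductionSqueezeOmegaOf.lean`.

`SqueezeLimit.omega_facts`: the facts on the bulk `Λ.Ω` of a `SqueezeLimit` (`omegaFacts` fed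
with the side structures `SqueezeLimit.sides`, the bulk path `bulkPath_joinedIn_of_eventually`
— its obstacle hypothesis from the density of pinned removed vertices in the closed cells — the
pinned window balls `ball_subset_closure_pinned`, and the no-long-fingers region of `D` pinned
by `τ`), together with the window regions inside the super-domain (`gateV_disjoint_cuts`,
`pathComponent_gateV_subset`) and a point of `E ∖ Ω` (a strip point below the gate line).
Registered carrier: `stub_carvedReduction_omegaOf`.
-/

noncomputable section

open scoped Topology
open Filter Set Metric
open Literature.Probability.LatticeModels (HexVertex hexGraph hexCenter triEmbed Site)
open Literature.Probability.RandomPlanarGeometry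

namespace Summit.CriticalPhenomena.SAWScalingLimit.Theorems.ObservableToSLE.TypeLadder

open Summit.CriticalPhenomena.SAWScalingLimit.Theorems.ObservableToSLER.BridgeGate

/-- **THE BULK OF THE LIMIT DATA**; see the module docstring. -/
theorem SqueezeLimit.omega_facts {D : DobrushinDomain} {a b : ℝ → HexVertex} {δ : ℕ → ℝ} {S T : ℕ → ℕ → Set HexVertex}
    {n n' : ℕ → ℕ} {q q' : ℕ → HexVertex} {κ : ℕ → ℕ} {ρ R : ℝ} {N : ℕ}
    (Λ : SqueezeLimit D a b δ S T n n' q q' κ ρ R N) {rs : ℝ} {Uf' : Set ℂ} (hUf'c : IsPreconnected Uf')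
    (hUf'D : Uf' ⊆ D.carrier) (hUf'disj : ∀ i, Disjoint Uf' (closedBall (D.pt i) R))
    (hUf'big : D.carrier \ (⋃ i : Fin 2, ball (D.pt i) rs) ⊆ Uf') (hrs₀ : R + ρ ≤ rs)
    (hrs₁ : 2 * rs ≤ dist (D.pt 0) (D.pt 1)) :
    IsOpen Λ.Ω ∧ IsConnected Λ.Ω ∧ (∀ i : Fin 2, {z : ℂ | (Λ.Pv i).im < z.im} ∩ ball (Λ.Pv i) (ρ / 2) ⊆ Λ.Ω) ∧
      Λ.Ω ⊆ Λ.E.carrier ∧ IsConnected Λ.Ωᶜ ∧ Λ.Dτ \ (⋃ i : Fin 2, closedBall (D.pt i - Λ.τ) rs) ⊆ Λ.Ω ∧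
      Λ.Ω ⊆ Λ.Dτ ∧ frontier Λ.Ω ⊆ (Λ.XS ∪ Λ.XT) ∪ frontier Λ.Dτ ∧ Λ.b₀ ∈ Λ.Ω ∧ Disjoint Λ.Ω (Λ.XS ∪ Λ.XT) ∧
      (∀ i : Fin 2, ball (Λ.Pv i) (ρ / 2) ⊆ closure Λ.Dτ) ∧
      (∀ i : Fin 2, Disjoint Λ.Ω (sideZone (Λ.Pv i) ρ (Λ.Kspv i) (Λ.Bdv i) (Λ.cellv i) (Λ.connv i) 0)) ∧
      (∀ (i : Fin 2) (k : Fin N) (z : ℂ), (∀ ℓ : Fin 3, |skewCoord ℓ (z - (Λ.cellv i k).1)| ≤ (Λ.cellv i k).2) →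
        dist z (D.pt i - Λ.τ) ≤ R) ∧
      (∀ t : ℝ, 0 < t → t ≤ ρ / 128 → ∀ i : Fin 2,
        pathComponentIn (gateV (Λ.Pv i) ρ t) (Λ.Pv i + ((ρ / 16 : ℝ) : ℂ) * Complex.I) ⊆ Λ.E.carrier) ∧
      (Λ.E.carrier \ Λ.Ω).Nonempty := by
  obtain ⟨⟨hXSc, hXSR, hL2S, hupS, hXS, hα₀, -, hbodyS, hLHWS, hZ0S⟩, ⟨hXTc, hXTR, hL2T, hupT, hXT, hα₁, -, hbodyT, hLHWT, hZ0T⟩⟩ :=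
    Λ.sides
  have hρ := Λ.hρ
  have hs0 : Tendsto (fun j => δ (κ j)) atTop (𝓝 0) := Λ.s0.mono_right nhdsWithin_le_nhds
  -- the pinned window balls
  have hballs : ∀ i : Fin 2, ball (Λ.Pv i) (ρ / 2) ⊆ closure Λ.Dτ := by
    refine Fin.forall_fin_two.2 ⟨?_, ?_⟩
    · exact ball_subset_closure_pinned Λ.hτ (Λ.hballs.mono fun j hj => hj.1)
    · exact ball_subset_closure_pinned Λ.hτ (Λ.hballs.mono fun j hj => hj.2)
  -- the bulk path
  have hX : ∀ᶠ j in atTop, ∀ z ∈ Λ.XS ∪ Λ.XT, ∃ v ∈ S (κ j) (n (κ j)) ∪ T (κ j) (n' (κ j)),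
      dist (((δ (κ j) : ℝ) : ℂ) * hexCenter v - ((δ (κ j) : ℝ) : ℂ) * triEmbed (Λ.x j)) z < ρ / 32 := by
    filter_upwards [hL2S (ρ / 32) (by positivity), hL2T (ρ / 32) (by positivity)] with j hjS hjT z hz
    rcases hz with hz | hz
    · obtain ⟨i, hi⟩ := mem_iUnion.1 hz
      obtain ⟨v, hv, hd⟩ := hjS i z hi
      exact ⟨v, Or.inl hv, hd⟩
    · obtain ⟨i, hi⟩ := mem_iUnion.1 hz
      obtain ⟨v, hv, hd⟩ := hjT i z hi
      exact ⟨v, Or.inr hv, hd⟩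
  have hpath := bulkPath_joinedIn_of_eventually (s := fun j => δ (κ j)) (y := Λ.x)
    (U := fun j => S (κ j) (n (κ j)) ∪ T (κ j) (n' (κ j))) (q := fun j => q (κ j)) (q' := fun j => q' (κ j))
    (Ω₀ := D.carrier) (X := Λ.XS ∪ Λ.XT) hρ Λ.spos hs0 Λ.hτ (fun j => Λ.hq2 j) (fun j => Λ.hq2' j) Λ.hwinq Λ.hwinq'
    Λ.hballq Λ.hballq' Λ.hwide Λ.hconvq Λ.hconvq' hX
  -- the no-long-fingers region, pinned
  set Uf : Set ℂ := (fun z => z - Λ.τ) '' Uf' with hUfdef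
  have hUf : IsPreconnected Uf := hUf'c.image _ (by fun_prop)
  have hUfD : Uf ⊆ Λ.Dτ := image_mono hUf'D
  have hUfball : ∀ i, Disjoint Uf (closedBall (D.pt i - Λ.τ) R) := by
    intro i; rw [disjoint_left]
    rintro _ ⟨w, hw, rfl⟩ hwb
    refine disjoint_left.1 (hUf'disj i) hw ?_
    rw [mem_closedBall] at hwb ⊢; rwa [dist_sub_right] at hwb
  have hUfbig : Λ.Dτ \ (⋃ i : Fin 2, ball (D.pt i - Λ.τ) rs) ⊆ Uf := by
    rintro _ ⟨⟨w, hw, rfl⟩, hnot⟩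
    refine ⟨w, hUf'big ⟨hw, fun h => hnot ?_⟩, rfl⟩
    obtain ⟨i, hi⟩ := mem_iUnion.1 h
    exact mem_iUnion.2 ⟨i, by rw [mem_ball] at hi ⊢; rwa [dist_sub_right]⟩
  have hfarU : ∀ z ∈ Λ.Dτ, dist z (D.pt 0 - Λ.τ) = rs → z ∈ Uf := by
    rintro _ ⟨w, hw, rfl⟩ hd
    rw [dist_sub_right] at hd
    refine ⟨w, hUf'big ⟨hw, fun h => ?_⟩, rfl⟩
    obtain ⟨i, hi⟩ := mem_iUnion.1 h
    rw [mem_ball] at hi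
    fin_cases i
    · simp at hi; linarith
    · simp at hi
      linarith [dist_triangle (D.pt 0) w (D.pt 1), dist_comm (D.pt 0) w]
  -- `omegaFacts`
  have hxx : ∀ i k, Λ.xx i k ∈ frontier Λ.J.carrier := fun i k => by
    fin_cases k
    · exact (Λ.hcross i).2.1
    · exact (Λ.hcross i).2.2.1
  have hPα' : ∀ i : Fin 2, dist (Λ.Pv i) (D.pt i - Λ.τ) ≤ R := by
    have h0 := Λ.hPα 0
    have h1 := Λ.hPα 1
    simp only [Matrix.cons_val_zero, Matrix.cons_val_one] at h0 h1
    exact Fin.forall_fin_two.2 ⟨h0, h1⟩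
  obtain ⟨hΩo, hΩc, hwin, hΩE, hΩcc, hfar, -, hfrΩ, hb₀⟩ := omegaFacts D Λ.τ (XS := Λ.XS) (XT := Λ.XT) (Uf := Uf)
    (E := Λ.E.carrier) (J := Λ.J.carrier) (L := Λ.L) (F := Λ.F) (Bd := Λ.Bdv) (xx := Λ.xx) (P := Λ.Pv) (ρ := ρ) (R := R)
    (rs := rs) hρ hXSc hXTc hXS hXT hα₀ hα₁ (fun z hz => mem_closedBall.2 (by obtain ⟨i, hi⟩ := mem_iUnion.1 hz; exact hXSR i z hi))
    (fun z hz => mem_closedBall.2 (by obtain ⟨i, hi⟩ := mem_iUnion.1 hz; exact hXTR i z hi)) hPα' Λ.hsep hupS hupT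
    hballs hpath Λ.hDJ Λ.J.isOpen Λ.hjoinE Λ.hLcut hxx Λ.hFD (Fin.forall_fin_two.2 ⟨hLHWS, hLHWT⟩)
    (Fin.forall_fin_two.2 ⟨hbodyS, hbodyT⟩) hUf hUfD hUfball hUfbig hfarU hrs₀ (by linarith)
  have hΩD : Λ.Ω ⊆ Λ.Dτ := fun z hz => (connectedComponentIn_subset _ _ hz).1
  have hΩX : Disjoint Λ.Ω (Λ.XS ∪ Λ.XT) := disjoint_left.2 fun z hz hzX => (connectedComponentIn_subset _ _ hz).2 hzX
  -- the unshrunk zones are off the bulk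
  have hΩ0 : ∀ i : Fin 2, Disjoint Λ.Ω (sideZone (Λ.Pv i) ρ (Λ.Kspv i) (Λ.Bdv i) (Λ.cellv i) (Λ.connv i) 0) := by
    refine Fin.forall_fin_two.2 ⟨?_, ?_⟩
    · exact disjoint_left.2 fun z hz hzZ => disjoint_left.1 hΩX hz (Or.inl (hZ0S hzZ))
    · exact disjoint_left.2 fun z hz hzZ => disjoint_left.1 hΩX hz (Or.inr (hZ0T hzZ))
  have hcellR : ∀ (i : Fin 2) (k : Fin N) (z : ℂ), (∀ ℓ : Fin 3, |skewCoord ℓ (z - (Λ.cellv i k).1)| ≤ (Λ.cellv i k).2) →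
      dist z (D.pt i - Λ.τ) ≤ R :=
    Fin.forall_fin_two.2 ⟨fun k z hz => hXSR k z hz, fun k z hz => hXTR k z hz⟩
  -- the window regions lie in the super-domain
  have hEJ' : Λ.E.carrier ⊆ Λ.J.carrier := fun z hz => (Λ.hEJ hz).1
  have hKdJ : closure Λ.Dτ ⊆ Λ.J.carrier := Λ.hDJ
  have hbaseΩ : ∀ i : Fin 2, Λ.Pv i + ((ρ / 16 : ℝ) : ℂ) * Complex.I ∈ Λ.Ω := fun i => hwin i (base_mem_window hρ)
  have hBne : ∀ i, (Λ.Bdv i).Nonempty := Fin.forall_fin_two.2 ⟨⟨_, Λ.hBS.2.2.1⟩, ⟨_, Λ.hBT.2.2.1⟩⟩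
  have hsep' : 2 * (R + ρ) < dist (![D.pt 0 - Λ.τ, D.pt 1 - Λ.τ] 0) (![D.pt 0 - Λ.τ, D.pt 1 - Λ.τ] 1) := by
    simp only [Matrix.cons_val_zero, Matrix.cons_val_one, dist_sub_right]; exact Λ.hsep
  have hVE : ∀ t : ℝ, 0 < t → t ≤ ρ / 128 → ∀ i : Fin 2,
      pathComponentIn (gateV (Λ.Pv i) ρ t) (Λ.Pv i + ((ρ / 16 : ℝ) : ℂ) * Complex.I) ⊆ Λ.E.carrier := by
    intro t ht htρ i
    have hcut := gateV_disjoint_cuts (L := Λ.L) (F := Λ.F) (Bd := Λ.Bdv) (xx := Λ.xx) (P := Λ.Pv)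
      (α := ![D.pt 0 - Λ.τ, D.pt 1 - Λ.τ]) (J := Λ.J.carrier) (Kd := closure Λ.Dτ) hρ ht.le htρ Λ.J.isOpen Λ.hLcut hxx hKdJ
      hballs (fun i => (Λ.hFD i).mono_left subset_closure) Λ.hBfar hBne Λ.hBR Λ.hPα hsep' i
    exact pathComponent_gateV_subset hcut ((gateV_subset_ball.trans (ball_subset_ball (by linarith))).trans ((hballs i).trans hKdJ))
      Λ.hjoinE Λ.E.isOpen Λ.E.isConnected Λ.hEJ (hΩE hb₀) (hΩE (hbaseΩ i))
  -- a point of `E ∖ Ω`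
  have hEΩ : (Λ.E.carrier \ Λ.Ω).Nonempty := by
    set z₁ : ℂ := Λ.P₀ + ((ρ / 32 : ℝ) : ℂ) - ((ρ / 512 : ℝ) : ℂ) * Complex.I with hz₁
    have hre : (z₁ - Λ.P₀).re = ρ / 32 := by rw [hz₁]; simp
    have him : (z₁ - Λ.P₀).im = -(ρ / 512) := by rw [hz₁]; simp
    have hz₁W : z₁ ∈ gateW Λ.P₀ ρ (ρ / 256) := by
      refine ⟨⟨?_, ?_⟩, fun h => ?_⟩
      · rw [mem_ball, dist_eq_norm]
        refine (Complex.norm_le_abs_re_add_abs_im _).trans_lt ?_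
        rw [hre, him, abs_neg, abs_of_pos (by positivity), abs_of_pos (by positivity)]; linarith
      · show Λ.P₀.im - ρ / 256 < z₁.im
        have : z₁.im = Λ.P₀.im - ρ / 512 := by have := him; rw [Complex.sub_im] at this; linarith
        linarith
      · have h1 := h.1
        have : z₁.re - Λ.P₀.re = ρ / 32 := by have := hre; rwa [Complex.sub_re] at this
        rw [this, abs_of_pos (by positivity)] at h1
        linarith
    refine ⟨z₁, hVE (ρ / 256) (by positivity) (by linarith) 0 (joinedIn_gateV hρ (by positivity) (by linarith) hz₁W).symm, ?_⟩
    intro hzΩ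
    refine disjoint_left.1 hΩX hzΩ (Or.inl (hLHWS ⟨?_, ?_⟩))
    · show z₁.im < Λ.P₀.im
      have : z₁.im = Λ.P₀.im - ρ / 512 := by have := him; rw [Complex.sub_im] at this; linarith
      linarith
    · rw [mem_ball, dist_eq_norm]
      refine (Complex.norm_le_abs_re_add_abs_im _).trans_lt ?_
      rw [hre, him, abs_neg, abs_of_pos (by positivity), abs_of_pos (by positivity)]; linarith
  exact ⟨hΩo, hΩc, hwin, hΩE, hΩcc, hfar, hΩD, hfrΩ, hb₀, hΩX, hballs, hΩ0, hcellR, hVE, hEΩ⟩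

/-- **Registered carrier `stub_carvedReduction_omegaOf`** (crux item stmt-CriticalPhenomena-10472, stub
T-A′₂F `stub_carvedReduction_squeezeGeometry_domainsCoreF`, piece THE BULK OF THE DATA): the bulk of a
`SqueezeLimit` is open. -/
theorem stub_carvedReduction_omegaOf {D : DobrushinDomain} {a b : ℝ → HexVertex} {δ : ℕ → ℝ}
    {S T : ℕ → ℕ → Set HexVertex} {n n' : ℕ → ℕ} {q q' : ℕ → HexVertex} {κ : ℕ → ℕ} {ρ R : ℝ} {N : ℕ}
    (Λ : SqueezeLimit D a b δ S T n n' q q' κ ρ R N) {rs : ℝ} {Uf' : Set ℂ} (hUf'c : IsPreconnected Uf')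
    (hUf'D : Uf' ⊆ D.carrier) (hUf'disj : ∀ i, Disjoint Uf' (closedBall (D.pt i) R))
    (hUf'big : D.carrier \ (⋃ i : Fin 2, ball (D.pt i) rs) ⊆ Uf') (hrs₀ : R + ρ ≤ rs)
    (hrs₁ : 2 * rs ≤ dist (D.pt 0) (D.pt 1)) : IsOpen Λ.Ω :=
  (Λ.omega_facts hUf'c hUf'D hUf'disj hUf'big hrs₀ hrs₁).1

end Summit.CriticalPhenomena.SAWScalingLimit.Theorems.ObservableToSLE.TypeLadder

end
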